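import Literature.AlgebraicGeometry.RelativeSpec.FiniteGroupQuotientFunctionField
import Literature.AlgebraicGeometry.Motives.FiniteQuotientQuasiProjective
import HarnessLib

/-!
# `[K(Y) : K(Y/Δ)] = |Δ|` for the finite quotient of an integral `k`-scheme (Mumford §7; SGA 1 V §2)

The `Motives.finiteQuotient` / `IsSepQuotient` packaging of
`RelativeSpec/FiniteGroupQuotientFunctionField` (`ActionOver.finrank_functionField_glued`): for a finite group
`Δ` acting FAITHFULLY by `k`-automorphisms on an INTEGRAL separated `k`-scheme `Y` covered by `Δ`-stable affine
opens (Mumford's hypothesis; automatic for `Y` projective over `k`),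

* `finrank_functionField_finiteQuotient` — `[K(Y) : K(Y/Δ)] = |Δ|` for the quotient morphism
  `finiteQuotient.mk ρ hcov : Y ⟶ Y/Δ` of ANY `ρ : ActionOver Y.hom Δ` with `ρ.aut` injective;
* `finrank_functionField_of_isSepQuotient` — the same for EVERY quotient `p : Y ⟶ Z` of `Y` by
  `act : Δ →* Aut Y` for separated test objects (`IsSepQuotient (fun g => act g) p`, `Z` separated and integral),
  in the currency `letI := (functionFieldMap p.left).toAlgebra; Module.finrank Z.left.functionField Y.left.functionField`
  of `CartierDivisor.map_cycle_pullback_eq_smul` (`Motives/CartierDivisorProjectionFormula`) — transported along the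
  comparison isomorphism `Z ≅ Y/Δ` (`isoFiniteQuotient_of_isSepQuotient_of_cover`).

So for a Galois cover `p : X → X/Δ` of integral projective curves the degree `deg(X/(X/Δ)) = [K(X) : K(X/Δ)]`
appearing in `p_*[p^*D] = deg • [D]` is `|Δ|`.  Everything is proved; no named facts, no definitions.

## References

* D. Mumford, *Abelian Varieties* (1970), §7, Thm. p. 66 (2) and Remark. [MumfordAV1970]
* J.-P. Serre, *Algebraic Groups and Class Fields*, GTM 117 (1988), Ch. III no. 12, Prop. 18 Cor. b)
  («`k(V/𝔤) = k(V)^𝔤`») and Remark 1. [Serre1988]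
-/

noncomputable section

universe u

open CategoryTheory Limits AlgebraicGeometry
open Literature.AlgebraicGeometry.RelativeSpec Literature.AlgebraicGeometry.Motives.RatFn

namespace Literature.AlgebraicGeometry.Motives


section FiniteQuotient

variable {k : Type u} [Field k] {Y : SchemeOver k} {G : Type*} [Group G] [Fintype G]
  [IsIntegral Y.left] [IsSeparated Y.hom] (ρ : ActionOver Y.hom G)
  (hcov : ∀ y : Y.left, ∃ O : ρ.StableAffineOpens, y ∈ O.1)

/-- **`[K(Y) : K(Y/G)] = |G|`** for the finite quotient `π : Y ⟶ Y/G` (`finiteQuotient.mk`) of an integral separated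
`k`-scheme by a finite group acting faithfully by `k`-automorphisms. [cite: MumfordAV1970, §7 Thm. p. 66 (2)]
[cite: Serre1988, Ch. III no. 12, Prop. 18 Cor. b)] -/
theorem finrank_functionField_finiteQuotient (hρ : Function.Injective ρ.aut) :
    haveI : IsIntegral (finiteQuotient ρ).left := ρ.isIntegral_glued hcov
    haveI : IsDominant (finiteQuotient.mk ρ hcov).left := ⟨(finiteQuotient.mk_left_surjective ρ hcov).denseRange⟩
    letI := (functionFieldMap (finiteQuotient.mk ρ hcov).left).toAlgebra
    Module.finrank (finiteQuotient ρ).left.functionField Y.left.functionField = Fintype.card G := by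
  haveI : (Spec (.of k)).IsSeparated := inferInstance
  exact ρ.finrank_functionField_glued hcov hρ

end FiniteQuotient

section SepQuotient

variable {k : Type u} [Field k] {Δ : Type} [Group Δ] [Fintype Δ] {Y Z : SchemeOver k}
  [IsIntegral Y.left] [IsIntegral Z.left] [IsSeparated Y.hom]

omit [Fintype Δ] [IsIntegral Y.left] [IsSeparated Y.hom] in
/-- The action `Δ →* Aut Y ↦ Δ →* Aut Y.left` is injective when `Δ →* Aut Y` is (the forgetful functor
`Over (Spec k) ⥤ Scheme` is faithful). [folklore] -/
private theorem injective_mapAut_comp (act : Δ →* Aut Y) (hact : Function.Injective act) :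
    Function.Injective (((Over.forget (Spec (.of k))).mapAut Y).comp act) := by
  intro g₁ g₂ hg
  apply hact
  ext : 1
  exact Over.OverMorphism.ext (congrArg (fun φ : Aut Y.left => φ.hom) hg)

/-- **`[K(Y) : K(Z)] = |Δ|` for every quotient `p : Y ⟶ Z` of `Y` by a faithful finite `Δ ≤ Aut_k(Y)` for
separated test objects** (`IsSepQuotient`), `Y`, `Z` integral and separated over `k`, `Y` covered by `Δ`-stable
affine opens: the quotient is Mumford's `Y/Δ` up to a unique isomorphism under `Y`
(`isoFiniteQuotient_of_isSepQuotient_of_cover`), and `functionFieldMap` of an isomorphism is a ring isomorphism,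
along which `finrank` is transported (`Algebra.finrank_eq_of_equiv_equiv`).  Currency = the degree
`[R(Y):R(Z)]` of `CartierDivisor.map_cycle_pullback_eq_smul`. [cite: MumfordAV1970, §7 Thm. p. 66 (Remark)]
[cite: Serre1988, Ch. III no. 12, Prop. 18 Cor. b)] -/
theorem finrank_functionField_of_isSepQuotient (act : Δ →* Aut Y) (hact : Function.Injective act)
    (hcov : ∀ y : Y.left, ∃ O : (⟨((Over.forget _).mapAut Y).comp act, fun g => Over.w (act g).hom⟩ :
        ActionOver Y.hom Δ).StableAffineOpens, y ∈ O.1)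
    (p : Y ⟶ Z) (hZ : IsSeparated Z.hom) (hq : IsSepQuotient (fun g => act g) p) [IsDominant p.left] :
    letI := (functionFieldMap p.left).toAlgebra
    Module.finrank Z.left.functionField Y.left.functionField = Fintype.card Δ := by
  set ρ : ActionOver Y.hom Δ := ⟨((Over.forget _).mapAut Y).comp act, fun g => Over.w (act g).hom⟩ with hρ
  obtain ⟨i, hi⟩ := isoFiniteQuotient_of_isSepQuotient_of_cover act hcov p hZ hq
  haveI : IsIntegral (finiteQuotient ρ).left := ρ.isIntegral_glued hcov
  haveI : IsDominant (finiteQuotient.mk ρ hcov).left := ⟨(finiteQuotient.mk_left_surjective ρ hcov).denseRange⟩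
  haveI : IsDominant i.hom.left := ⟨(Scheme.Hom.homeomorph i.hom.left).surjective.denseRange⟩
  haveI : IsDominant i.inv.left := ⟨(Scheme.Hom.homeomorph i.inv.left).surjective.denseRange⟩
  have key := finrank_functionField_finiteQuotient ρ hcov (injective_mapAut_comp act hact)
  -- `functionFieldMap` of the comparison iso `i : Z ≅ Y/Δ` is a ring isomorphism `K(Y/Δ) ≃ K(Z)`
  have h1 : (functionFieldMap i.inv.left).comp (functionFieldMap i.hom.left) = RingHom.id _ := by
    rw [← functionFieldMap_comp, functionFieldMap_congr (show i.inv.left ≫ i.hom.left = 𝟙 _ by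
      rw [← Over.comp_left, i.inv_hom_id]; rfl)]
    exact functionFieldMap_id
  have h2 : (functionFieldMap i.hom.left).comp (functionFieldMap i.inv.left) = RingHom.id _ := by
    rw [← functionFieldMap_comp, functionFieldMap_congr (show i.hom.left ≫ i.inv.left = 𝟙 _ by
      rw [← Over.comp_left, i.hom_inv_id]; rfl)]
    exact functionFieldMap_id
  let j : (finiteQuotient ρ).left.functionField ≃+* Z.left.functionField :=
    RingEquiv.ofRingHom (functionFieldMap i.hom.left) (functionFieldMap i.inv.left) h2 h1
  have hc : (functionFieldMap p.left).comp j.toRingHom = functionFieldMap (finiteQuotient.mk ρ hcov).left := by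
    rw [functionFieldMap_congr (show (finiteQuotient.mk ρ hcov).left = p.left ≫ i.hom.left by
      rw [← Over.comp_left, hi]), functionFieldMap_comp]
    rfl
  letI := (functionFieldMap p.left).toAlgebra
  letI := (functionFieldMap (finiteQuotient.mk ρ hcov).left).toAlgebra
  exact (Algebra.finrank_eq_of_equiv_equiv j (RingEquiv.refl _) (by
    rw [RingEquiv.toRingHom_refl, RingHom.id_comp]; exact hc)).symm.trans key

end SepQuotient

end Literature.AlgebraicGeometry.Motives

end
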